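import Mathlib
import Summits.Ventures.PercRepro2.CoinTreeCore
import Summits.Ventures.PercRepro2.CoinOrTailKDefs
import Summits.Ventures.PercRepro2.CoinKSureMarkerBExample
import Summits.Ventures.PercRepro2.CoinKSureMarkerBCoins

/-!
# A marker at a second OR-vertex, arbitrary coins: the instance (blind cell PercRepro2,
night-2 g15; NIGHT2-DARC.md §54)

The 14-coin system of `CoinKSureMarkerBExample` on `Fin 10`: row 2′DARC at `a → w` for the
markers `(m, b)` — the second marker at the OR-vertex `b` of the head — for EVERY probability
vector, no hypothesis (`darc_markerB_example_coins`), and for the markers `(b, m)`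
(`darc_markerB_example_coins'`), by `darc_of_orTailTreeK_markerB_coins` /
`darc_of_orTailK_markerB_coins'` (§54).
-/

namespace Summit.Ventures.PercRepro2.Coin

namespace MarkerBExample

open Classical

/-- **Row 2′DARC at `a → w` for the markers `(m, b)` on the 14-coin instance, every probability
vector — no hypothesis.** -/
theorem darc_markerB_example_coins {R : Type*} [Field R] [LinearOrder R] [IsStrictOrderedRing R]
    (pr : Fin 14 → R) (hp : IsProbVec pr) :
    DARC pr arcsMB 0 {9} 1 7 6 8 :=
  darc_of_orTailTreeK_markerB_coins pr hp sameEnds_mb orTailK_mb orTailKb_mb (by decide)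
    treeCore_mb (by decide) (by decide) (by decide) (by decide) (by decide)

/-- **Row 2′DARC at `a → w` for the markers `(b, m)` on the 14-coin instance, every probability
vector — no hypothesis.** -/
theorem darc_markerB_example_coins' {R : Type*} [Field R] [LinearOrder R] [IsStrictOrderedRing R]
    (pr : Fin 14 → R) (hp : IsProbVec pr) :
    DARC pr arcsMB 0 {9} 7 1 6 8 :=
  darc_of_orTailK_markerB_coins' pr hp sameEnds_mb orTailK_mb orTailKb_mb (by decide)
    (by decide) (treeCore_mb.coreLevel_lsm pr hp) (by decide) (by decide) (by decide) (by decide)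

end MarkerBExample

end Summit.Ventures.PercRepro2.Coin
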